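import Summits.QuantumFields.YangMills.Theorems.SwapVirialDeficitBlowUpGnomonicFibreHessianAngle
import Summits.QuantumFields.YangMills.Theorems.SwapVirialDeficitBlowUpGnomonicCartHubFrame
import Summits.QuantumFields.YangMills.Theorems.SwapVirialDeficitBlowUpGnomonicBaseFlat
import Summits.QuantumFields.YangMills.Theorems.SwapVirialDeficitBlowUpGnomonicApexProjection
import HarnessLib

/-!
# Route `SwapVirialDeficit` (YangMills): THE APEX-SOFT DIRECTIONS — the first-order soft-pair ceiling `Q_{angUnit θ,ε,p}(v) ≤ 122689728·L⁴·|θ|·‖v‖²`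
# (cell ym-idea-1, skeleton ➎; brick of w2 g60's memo3 §5 for `stub_core_tip`: the CEILING half of the Hessian sandwich on the soft pair;
# free-hands support of ⟨stmt-QuantumFields-24197⟩ `SwapVirialDeficit.SwapGluedStiffness`)

At the apex hub `1` every COAXIAL leader configuration `(αd, βd, 0; 0)` is flat (rotation invariance ✓`gnoDeficit_one_realHub_rot` + ✓`gnoDeficit_base_eq_zero`), and the
fibre line `gnoBase p + s·ξ(v)` through the flat base point in a SOFT direction `v` (fibre blocks `u = p₁e, v = p₂e, z = 0, η_F = 0`) stays coaxial:
`x = p₁(1, s e)`, `y = p₂(1, s e)`.  Hence the apex fibre form vanishes on the soft plane, and by ✓`fibQ_angUnit_le_apex_add`: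
* `exists_rot3_e0_eq` (a unit `u` with `rot3 u e₀ = n` for every unit `n ∈ ℝ³`, from ✓`exists_conj_axisPoint_eq`), ★ `gnoDeficit_apex_coaxial_eq_zero`,
  ★ `fibQ_apex_softDir_eq_zero`, ★★ `fibQ_angUnit_softDir_le` — `Q_{angUnit θ,ε,p}(v) ≤ 122689728·L⁴·|θ|·‖v‖²` (`sin θ ≥ 0`, principal signs).
No fourth-order calculus: the soft pair's ceiling is FIRST order in `θ`, which costs only `r⁻²` in the tip∕shell share (memo3 §5).

HONEST LABEL: algebra on landed results; `stub_core_tip` and the other stubs, ⟨24197⟩ ∕ ⟨24194⟩ OPEN; own crux ⟨22884⟩ `LargeFieldMassRefinementTail` OPEN (blocked-on ⟨19935⟩); the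
Yang–Mills mass gap is NOT proved; no summit is proved by a line.  THEOREMS ONLY (0 `def`, 0 `sorry`), standard axioms.  Width seat ym-line-sfw-p2-w2 g60 (cell ym-idea-1,
free hands), `--supports stmt-QuantumFields-24197`.  References: [cite: tHooft1979]; [folklore].
-/

set_option autoImplicit false

noncomputable section

open Quaternion Set
open scoped Quaternion
open Literature.MathematicalPhysics.QuantumLattice
open Literature.MathematicalPhysics.QuantumFieldTheory hiding SU2

namespace Summit.QuantumFields.YangMills.Theorems.SwapVirialDeficit.BlowUpRing

open Summit.QuantumFields.YangMills.Theorems.FemtoTransferGap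
open Summit.QuantumFields.YangMills.Theorems.FemtoTransferGap.TT
open Summit.QuantumFields.YangMills.Theorems.VirialFluxGap.RingDeficit
open Summit.QuantumFields.YangMills.Theorems.SwapVirialDeficit.SwapRing
open Summit.QuantumFields.YangMills.Theorems.SwapVirialDeficit.SectorLaplace
open Summit.QuantumFields.YangMills.Theorems.SwapVirialDeficit.Gnomonic (normSq3)
open Summit.QuantumFields.YangMills.Theorems.SwapTwistDeficit.ToronLog (axisPoint)

variable {L : ℕ} [NeZero L]

/-! ## §1 A rotation taking `e₀` to a given unit vector -/

omit [NeZero L] in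
/-- For every unit vector `n ∈ ℝ³` there is a unit quaternion `u` with `rot3 u e₀ = n` (`e₀ = (1,0,0)`): conjugate `i` to the pure quaternion `(0, n)` (✓`exists_conj_axisPoint_eq`).
[folklore] -/
theorem exists_rot3_e0_eq (n : Fin 3 → ℝ) (hn : normSq3 n = 1) : ∃ u : ℍ, ‖u‖ = 1 ∧ rot3 u ![1, 0, 0] = n := by
  set N : ℍ := (⟨0, n 0, n 1, n 2⟩ : ℍ) with hN
  obtain ⟨u, hu, hconj⟩ := exists_conj_axisPoint_eq N
  have hnorm : ‖N.im‖ = 1 := by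
    have h := WeakCouplingRates.sq_norm_im N
    have hn' : n 0 ^ 2 + (n 1 ^ 2 + n 2 ^ 2) = 1 := by rw [← normSq3_eq_three n]; exact hn
    have h1 : ‖N.im‖ ^ 2 = 1 := by rw [h, hN]; simp only; linarith
    nlinarith [norm_nonneg N.im]
  have hre : N.re = 0 := by rw [hN]
  have hax : axisPoint N = (⟨0, 1, 0, 0⟩ : ℍ) := by
    rw [axisPoint, hnorm, hre]
  obtain ⟨huu, huu'⟩ := star_mul_self_of_unit hu
  refine ⟨u, hu, ?_⟩
  -- `ū (1 + i) u = 1 + ū i u = 1 + N`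
  set qI : ℍ := (⟨0, 1, 0, 0⟩ : ℍ) with hqI
  have hg : gnomonicQuat ![1, 0, 0] = 1 + qI := by
    rw [hqI]; ext <;> simp [gnomonicQuat]
  have hc : star u * gnomonicQuat ![1, 0, 0] * u = 1 + N := by
    rw [hg, mul_add, add_mul, mul_one, huu, ← hax, hconj]
  funext k
  fin_cases k <;> simp [rot3, hc, hN]

/-! ## §2 Coaxial configurations are flat at the apex -/

/-- ★ **COAXIAL LEADERS ARE FLAT AT THE APEX**: for principal signs and every `d ∈ ℝ³`, `α, β`:
`F̂_{1,ε}((αd, βd), 0, 0) = 0` (✓`gnoDeficit_one_realHub_rot` with the rotation of §1 + ✓`gnoDeficit_base_eq_zero`). [cite: tHooft1979] -/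
theorem gnoDeficit_apex_coaxial_eq_zero (ε : GnoSign L) (hz : ε.2.1 = true) (hF : ε.2.2 = fun _ => true) (d : Fin 3 → ℝ) (α β : ℝ) :
    gnoDeficit z₀ (fun _ => 1) ((1 : ℝ) : ℍ) ε ((((α • d), (β • d)), ((0 : Fin 3 → ℝ), (0 : Fol L → Fin 3 → ℝ))) : GnoCoord L) = 0 := by
  by_cases hd : normSq3 d = 0
  · have hd0 : d = 0 := eq_zero_of_normSq3_eq_zero hd
    have h := gnoDeficit_base_eq_zero (L := L) (a := ((1 : ℝ) : ℍ)) (by norm_num) ε hz hF 0 0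
    rw [hd0, smul_zero, smul_zero]
    have e : ((((![(0 : ℝ), 0, 0] : Fin 3 → ℝ), (![(0 : ℝ), 0, 0] : Fin 3 → ℝ)), ((0 : Fin 3 → ℝ), (0 : Fol L → Fin 3 → ℝ))) : GnoCoord L) =
        (((0 : Fin 3 → ℝ), (0 : Fin 3 → ℝ)), ((0 : Fin 3 → ℝ), (0 : Fol L → Fin 3 → ℝ))) := by
      refine Prod.ext (Prod.ext ?_ ?_) rfl <;> (funext k; fin_cases k <;> simp)
    rw [e] at h
    exact h
  · -- normalise and rotate
    have hpos : 0 < normSq3 d := lt_of_le_of_ne (Gnomonic.normSq3_nonneg d) (Ne.symm hd)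
    set r : ℝ := Real.sqrt (normSq3 d) with hr
    have hr0 : 0 < r := Real.sqrt_pos.2 hpos
    have hr2 : r ^ 2 = normSq3 d := Real.sq_sqrt hpos.le
    set n : Fin 3 → ℝ := r⁻¹ • d with hn
    have hn1 : normSq3 n = 1 := by
      rw [hn, Gnomonic.normSq3_smul, ← hr2, inv_pow, inv_mul_cancel₀ (pow_ne_zero 2 hr0.ne')]
    obtain ⟨u, hu, hrot⟩ := exists_rot3_e0_eq n hn1
    have hdn : d = r • n := by rw [hn, smul_smul, mul_inv_cancel₀ hr0.ne', one_smul]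
    have hrotc : ∀ c : ℝ, rot3 u ![c, 0, 0] = c • n := fun c => by
      have e : (![c, 0, 0] : Fin 3 → ℝ) = c • ![1, 0, 0] := by funext k; fin_cases k <;> simp
      rw [e, rot3_smul, hrot]
    have hconf : gnoRot u ((((![α * r, 0, 0] : Fin 3 → ℝ), (![β * r, 0, 0] : Fin 3 → ℝ)), ((0 : Fin 3 → ℝ), (0 : Fol L → Fin 3 → ℝ))) : GnoCoord L) =
        ((((α • d), (β • d)), ((0 : Fin 3 → ℝ), (0 : Fol L → Fin 3 → ℝ))) : GnoCoord L) := by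
      simp only [gnoRot, hrotc, rot3_zero, hdn, smul_smul]
      refine Prod.ext rfl (Prod.ext rfl ?_)
      funext f
      exact rot3_zero u
    rw [← hconf, gnoDeficit_one_realHub_rot z₀ one_ne_zero hu]
    exact gnoDeficit_base_eq_zero (L := L) (a := ((1 : ℝ) : ℍ)) (by norm_num) ε hz hF (α * r) (β * r)

/-! ## §3 The apex fibre form vanishes on the soft plane; the first-order ceiling -/

/-- ★ **THE APEX FIBRE FORM VANISHES ON THE SOFT DIRECTIONS**: if the fibre blocks of `y` are `u = p₁e`, `v = p₂e`, `z = 0`, `η_F = 0` (a joint tilt of the two free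
leaders), then `Q_{1,ε,p}(y) = 0` — the fibre line `gnoBase p + s·ξ(y)` is coaxial (`x = p₁(1, se)`, `y = p₂(1, se)`), hence flat for every `s`. [folklore] -/
theorem fibQ_apex_softDir_eq_zero (ε : GnoSign L) (hz : ε.2.1 = true) (hF : ε.2.2 = fun _ => true) (p : ℝ × ℝ) (e : Fin 2 → ℝ) (y : GnoFibre L)
    (hy : gnoFibreBlocks y = (((p.1 • e), (p.2 • e)), ((0 : Fin 3 → ℝ), (0 : Fol L → Fin 3 → ℝ)))) :
    fibQ ((1 : ℝ) : ℍ) ε p y = 0 := by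
  have hline : ∀ s : ℝ, gnoBase p.1 p.2 + s • gnoFibreEmb y =
      ((((p.1 • (![1, s * e 0, s * e 1] : Fin 3 → ℝ)), (p.2 • (![1, s * e 0, s * e 1] : Fin 3 → ℝ))), ((0 : Fin 3 → ℝ), (0 : Fol L → Fin 3 → ℝ))) : GnoCoord L) := by
    intro s
    have hb := hy
    rw [gnoFibreEmb_eq_fibreDir, hb]
    simp only [gnoBase, Prod.smul_mk, Prod.mk_add_mk, smul_zero, add_zero, Pi.smul_apply, smul_eq_mul]
    refine Prod.ext (Prod.ext ?_ ?_) rfl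
    · funext k; fin_cases k <;> simp <;> ring
    · funext k; fin_cases k <;> simp <;> ring
  have hzero : (fun s : ℝ => gnoDeficit z₀ (fun _ => 1) ((1 : ℝ) : ℍ) ε (gnoBase p.1 p.2 + s • gnoFibreEmb y)) = fun _ => 0 := by
    funext s
    rw [hline s]
    exact gnoDeficit_apex_coaxial_eq_zero ε hz hF _ p.1 p.2
  unfold fibQ
  rw [hzero, iteratedDeriv_const]
  simp

/-- ★★ **THE FIRST-ORDER SOFT-PAIR CEILING**: for `sin θ ≥ 0`, principal signs and `y` in the soft plane of the base point `p` (blocks `u = p₁e, v = p₂e, 0, 0`),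
`Q_{angUnit θ,ε,p}(y) ≤ 122689728·L⁴·|θ|·‖y‖²` (✓`fibQ_angUnit_le_apex_add` + §3). [cite: Luscher1983, §2] -/
theorem fibQ_angUnit_softDir_le {θ : ℝ} (hθ : 0 ≤ Real.sin θ) (ε : GnoSign L) (hz : ε.2.1 = true) (hF : ε.2.2 = fun _ => true) (p : ℝ × ℝ) (e : Fin 2 → ℝ)
    (y : GnoFibre L) (hy : gnoFibreBlocks y = (((p.1 • e), (p.2 • e)), ((0 : Fin 3 → ℝ), (0 : Fol L → Fin 3 → ℝ)))) :
    fibQ (angUnit θ) ε p y ≤ 122689728 * (L : ℝ) ^ 4 * |θ| * ‖y‖ ^ 2 := by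
  have h := fibQ_angUnit_le_apex_add (L := L) hθ ε p y
  have h0 : fibQ (1 : ℍ) ε p y = 0 := by
    have := fibQ_apex_softDir_eq_zero ε hz hF p e y hy
    rwa [Quaternion.coe_one] at this
  rw [h0, zero_add] at h
  exact h

end Summit.QuantumFields.YangMills.Theorems.SwapVirialDeficit.BlowUpRing

end
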